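import Summits.QuantumFields.YangMills.Theorems.IR.AfPincerUcFormat
import Summits.QuantumFields.YangMills.Theorems.IR.Negative.OnsetUcFalseOfMonopoleWire

/-!
# Line `af-pincer` — slot `af-pincer-Uc`, STUB RESHAPE «SC ∕ NSC split» (owner REGISTRY WRITE #5, ruling R89, 2026-08-27)

WHY (trigger R59-U «a typed negative kills a UKP-specific clause in the intended world»): the Negative lane landed
`Theorems/IR/Negative/OnsetUcFalseOfMonopoleWire.lean` (p521601, refuter `ym-19354-disprove-1` g6):
`OnsetFormatsUc.not_onsetMixingTypicalUKPc_of_monopoleWire : MonopoleWire → ¬ OnsetMixingTypicalUKPc`, where `MonopoleWire`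
(physics-grade TRUE at the certified admissible, NOT simply connected `SO(3)`: a forced `ℤ₂`-monopole world-line imposed by the
exterior data polarises the centre cell at EVERY mesh — Mack–Pietarinen 1982 (1.1); tree `Cruxes/NonSimplyConnectedLatticeGap/…`)
says that format Uc («ALL exterior data») is the wrong format for groups with `π₁ ≠ 1`: topologically non-trivial exterior sectors
cannot be screened at any scale.  The registered I-stub `stub_onsetUc : OnsetMixingTypicalUKPc` quantified over ALL compact simple
`G`; it is therefore MISSTATED (physics grade) on the non-simply-connected family and fine on the simply connected one (`SU(N)`,
`Sp(N)`, `Spin(N)`, simply connected exceptional forms), where the verdict of record stays NOT REFUTED (disprove-1 `NOT-REFUTED.md` §11).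

THE RESHAPE (minimal; owner's single-slot pen; repair (R1) of the disprover's menu with an explicit residual):
* `stub_typCriterionUc : TypCriterionUKPc` — VERBATIM (E^c; S1's closing theorem keeps its name and statement);
* `stub_afOnsetUc : AFToOnsetUKPc` — VERBATIM (X^c; S2; vacuous-grade on the NSC family anyway);
* `stub_onsetUcSC : OnsetFormatsUc.OnsetMixingTypicalUKPcSC` — NEW NAME, the disprover's typed repaired statement C′ BY NAME
  (= the old statement + the hypothesis `SimplyConnectedSpace G`; tree constant of `…Negative.OnsetUcFalseOfMonopoleWire`, importable
  from `Theorems/`; its `TypShellCondUKPc` is the mirror constant, definitionally the slot's by `typShellCondUKPc_iff_mirror`);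
* `stub_irNSC` — NEW, the HONEST RESIDUAL: the crux's own clause on the NON-simply-connected compact simple family (stated inline
  over tree declarations; UNSTAFFED; no line registered; candidate formats: «GOOD exterior data» Uc ∕ format T, both of which void the
  forced-defect mechanism; on the UV side of the route these groups are already inside the residual `UVOtherGroups`).
The composition `IR_of_stubsUcSC` concludes the ROUTE DECL `Summit.QuantumFields.YangMills.Theses.BalabanLadder.IR` BY NAME by cases on
`SimplyConnectedSpace G`: the SC branch is the slot's per-group pincer (`fmtClustering_of_typCriterionUKPc` ⊕ `fmtOnset_pinned` ⊕
`gapInUnits_of_fmtOnset`, proof = the body of the module's `irCal_of_pincerUc` with the extra hypothesis threaded), the NSC branch is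
the residual stub.  `sorry` occurs only inside the four stubs.

UNCHANGED: slot name, line card `Cruxes/IR/Lines/af-pincer.md`, the format module (p517602), every landed supplier file (the LEAD's
reductions restrict to the SC family by adding one hypothesis), the E^c ∕ X^c desks, THE NUMBER, the route (rev 9) and `closes`.
NAMED FALLBACK CHAIN: this file → re-based Uc 7eb42365f8aba369 (only if C′ itself is refuted-as-misstated again and the split must be
re-drawn) → U fc8c6b10a3fbcbe2 → T 0308f95ca6f6a115 (under a PROVED `WildWire`: T directly).
-/

set_option autoImplicit false

noncomputable section

open Filter Topology MeasureTheory
open Literature.MathematicalPhysics.QuantumFieldTheory Literature.MathematicalPhysics.QuantumLattice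
open Summit.QuantumFields.YangMills.Cruxes.OSLegsFromFemtoAndGap.DlrCollarTransfer (GapInUnits LowerBounds)

namespace Summit.QuantumFields.YangMills.Cruxes.IR.AfPincerUc

/-! ## §D′ Four REGISTERED stubs + the kernel-checked composition concluding `IR` BY NAME -/

/-- stub E^{Uc} (PORT, M — engine glue, group-blind): **UKP-typical-data criterion, clause (i) at every centre**.  VERBATIM. -/
theorem stub_typCriterionUc : TypCriterionUKPc := by
  sorry

/-- stub I^{Uc}_SC (research, XL — IR side; the LEAD's stub): **UKP-typical onset mixing with clause (i) at every centre, for every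
SIMPLY CONNECTED compact simple `G`** — the disprover's repaired statement C′ `OnsetFormatsUc.OnsetMixingTypicalUKPcSC` BY NAME. -/
theorem stub_onsetUcSC : OnsetFormatsUc.OnsetMixingTypicalUKPcSC := by
  sorry

/-- stub X^{Uc} (research, L–XL — UV side; S2's stub): **asymptotic freedom up to the onset `mixOnsetUc`**.  VERBATIM. -/
theorem stub_afOnsetUc : AFToOnsetUKPc := by
  sorry

/-- stub R_NSC (RESIDUAL, unstaffed, no line): **the crux's clause on the NON-simply-connected compact simple family** — for such
`G`, every lattice representation `r` and every positive unit map `a → 0`, `LowerBounds G r a → GapInUnits G r a`.  Honest residual: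
format Uc is wrong there (forced `π₁`-defects); a «good exterior data» format or format T would be the line, none is registered. -/
theorem stub_irNSC :
    ∀ (G : Type) [Group G] [TopologicalSpace G] [IsTopologicalGroup G] [CompactSpace G],
      IsCompactSimpleLieGroup G → ¬ SimplyConnectedSpace G →
      letI : MeasurableSpace G := borel G; haveI : BorelSpace G := ⟨rfl⟩;
      ∀ (r : LatticeRep G) (a : ℝ → ℝ), (∀ β, 0 < a β) → Tendsto a atTop (𝓝 0) →
        LowerBounds G r a → GapInUnits G r a := by
  sorry

/-- **Composition of the split cut (real proof): `E^c → I^c_SC → X^c → R_NSC → IRCal`**, by cases on `SimplyConnectedSpace G`;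
the SC branch is the module's per-group pincer at `P β b := TypShellCondUKPc r.ρ β b n ε δ₀`. -/
theorem irCal_of_pincerUcSC (hE : TypCriterionUKPc) (hI : OnsetFormatsUc.OnsetMixingTypicalUKPcSC) (hX : AFToOnsetUKPc)
    (hN : ∀ (G : Type) [Group G] [TopologicalSpace G] [IsTopologicalGroup G] [CompactSpace G],
      IsCompactSimpleLieGroup G → ¬ SimplyConnectedSpace G →
      letI : MeasurableSpace G := borel G; haveI : BorelSpace G := ⟨rfl⟩;
      ∀ (r : LatticeRep G) (a : ℝ → ℝ), (∀ β, 0 < a β) → Tendsto a atTop (𝓝 0) →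
        LowerBounds G r a → GapInUnits G r a) :
    IRCal := by
  intro G _ _ _ _ hG
  letI : MeasurableSpace G := borel G
  haveI : BorelSpace G := ⟨rfl⟩
  intro r a ha ha0 hlb
  by_cases hsc : SimplyConnectedSpace G
  · obtain ⟨n, ε, hn, hε, hM, hIδ⟩ := hI G hG hsc r
    obtain ⟨δ₀, κ, s₀, hδ₀, hκ, hcl⟩ := fmtClustering_of_typCriterionUKPc hE r hn hε hM
    obtain ⟨β₂, hon⟩ := hIδ δ₀ hδ₀
    obtain ⟨T, β₆, hpin⟩ :=
      fmtOnset_pinned (fun β' b => TypShellCondUKPc r.ρ β' b n ε δ₀) r a ha hlb (hX G hG r n ε hn hε hM δ₀ hδ₀)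
    exact gapInUnits_of_fmtOnset r a ha hκ hcl
      (fun β hβ => by
        obtain ⟨b, hb, hP⟩ := hon β hβ
        exact ⟨b, hb, (typShellCondUKPc_iff_mirror r.ρ β b n ε δ₀).mpr hP⟩) hpin
  · exact hN G hG hsc r a ha ha0 hlb

/-- **The split cut concludes the route decl BY NAME from the four named stubs** (consumes exactly `stub_typCriterionUc`,
`stub_onsetUcSC`, `stub_afOnsetUc`, `stub_irNSC`; `sorry` occurs only inside the stubs; `IR`'s body is `IRCal` verbatim). -/
theorem IR_of_stubsUcSC : Summit.QuantumFields.YangMills.Theses.BalabanLadder.IR := by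
  have h : IRCal := irCal_of_pincerUcSC stub_typCriterionUc stub_onsetUcSC stub_afOnsetUc stub_irNSC
  delta Summit.QuantumFields.YangMills.Theses.BalabanLadder.IR
  delta Summit.QuantumFields.YangMills.Cruxes.IR.AfPincerUc.IRCal at h
  exact h

end Summit.QuantumFields.YangMills.Cruxes.IR.AfPincerUc

end
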